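import Literature.Topology.FourManifolds.IwaseHandlePhi
import HarnessLib

/-!
# The global model maps `Φ`, `Ψ` of the Iwase model on `S² × ℝ²`

Auxiliary construction for the model datum of Iwase's Proposition 3.5
[cite: Iwase1988, Prop. 3.5, p. 296; proof p. 297] (`Iwase1988_gluckTwist_isTorusLinkSurgery`,
reduced to a model problem on `S² × ℝ²` in `TorusSurgeryIwaseReduction`, which asks for maps
`Φ`, `Ψ` smooth and mutually inverse off two tori, with `Φ = G⁻¹` far from the sphere).

The model map `Phi` is defined piecewise: the polar model `IwasePolar.polarMap` on the polar
region `N = {‖w‖ < 197/200}`, the handle model `PhiH` (`IwaseHandlePhi`) on the handle `Hset`,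
and the inverse Gluck map elsewhere; `Psi` likewise with `polarMapInv`, `PsiH`, `gluckMap`.

Main results:
* the tori `Sigma0 = SigmaN ∪ SigmaH` (polar torus `w = g(x)` inside `N`, and the handle core)
  and `Sigma1 = SigmaN ∪ G⁻¹(SigmaH)`; `polar_iff_core` (inside the band the two descriptions of
  the torus agree), `Hoff` (the handle off the core, open);
* `Phi_of_Hoff` (`Φ = Φ_H` on the whole handle off the core, by the matching
  `PhiH_eq_polarMap`), `Psi_Phi`, `Phi_Psi` (mutual inverses off the tori, with the image
  tori exchanged), `Phi_far` (`Φ = G⁻¹` for `‖w‖ ≥ 4`);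
* smoothness: `contMDiffOn_Phi` off `Sigma0`, `contMDiffOn_Psi` off `Sigma1`.  At exterior
  points `Φ = G⁻¹` nearby (`Phi_eventuallyEq_ext`): handle points outside the compact block
  `h(Kc)` and outside `N` have complete slice cut-off, and polar points near an exterior boundary
  point have complete polar cut-off (`muP_eq_one_eventually`, using `mem_Hset_of_boundary`: a
  boundary point of `N` with small slice radius lies on the handle).

All statements are elementary [folklore] bookkeeping around the cited construction.

## References
* Z. Iwase, *Dehn-surgery along a torus T²-knot*, Pacific J. Math. 133 (1988), 289–299,
  Prop. 3.5. [cite: Iwase1988]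
-/

open scoped ContDiff Manifold Topology
open Set Function Real Metric

noncomputable section

namespace Literature.Topology.FourManifolds

namespace IwaseHandle

open HandlePlanar UnknotSurgery

/-! ### Complements on the polar model: the inverse map -/

/-- **The inverse polar map is smooth off the torus** (same proof as for `polarMap`, with the
phase inverted). [folklore] -/
theorem contMDiffAt_polarMapInv {q : sphere (0 : EuclideanSpace ℝ (Fin 3)) 1 × EuclideanSpace ℝ (Fin 2)}
    (hw1 : ‖q.2‖ < 1) (hwg : toC q.2 ≠ IwasePolar.gprof (IwasePolar.xsq q.1)) :
    ContMDiffAt ((𝓡 2).prod 𝓘(ℝ, EuclideanSpace ℝ (Fin 2)))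
      ((𝓡 2).prod 𝓘(ℝ, EuclideanSpace ℝ (Fin 2))) ∞ IwasePolar.polarMapInv q := by
  have hw1' : ‖toC q.2‖ < 1 := by rwa [norm_toC]
  have hx : -(1 - ‖toC q.2‖) / 2 < IwasePolar.xsq q.1 := by
    have := IwasePolar.xsq_nonneg q.1; rw [norm_toC]; linarith
  have hin : ContMDiffAt ((𝓡 2).prod 𝓘(ℝ, EuclideanSpace ℝ (Fin 2))) 𝓘(ℝ, ℝ × ℂ) ∞
      (fun q : sphere (0 : EuclideanSpace ℝ (Fin 3)) 1 × EuclideanSpace ℝ (Fin 2) =>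
        (IwasePolar.xsq q.1, toC q.2)) q :=
    (IwasePolar.contMDiff_xsq.contMDiffAt.comp q contMDiffAt_fst).prodMk_space
      (contDiff_toC.contMDiff.contMDiffAt.comp q contMDiffAt_snd)
  have hpol := ((IwasePolar.contDiffAt_pol hw1' hx hwg).inv
    (IwasePolar.pol_ne_zero hw1' hwg)).contMDiffAt.comp q hin
  have hcirc := (IwasePolar.contMDiffAt_circleOf (inv_ne_zero
    (IwasePolar.pol_ne_zero hw1' hwg))).comp q hpol
  have hrot := contMDiff_rotateSphereTwo.contMDiffAt.comp q (hcirc.prodMk contMDiffAt_fst)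
  exact hrot.prodMk contMDiffAt_snd

/-- **The inverse polar map is the Gluck map where the slice cut-off is complete.** [folklore] -/
theorem polarMapInv_eq_gluckMap_of_muP {q : sphere (0 : EuclideanSpace ℝ (Fin 3)) 1 ×
    EuclideanSpace ℝ (Fin 2)} (hw : 17 / 20 ≤ ‖q.2‖)
    (hμ : IwasePolar.muP (IwasePolar.xsq q.1) (toC q.2) = 1) :
    IwasePolar.polarMapInv q = gluckMap q := by
  obtain ⟨p, w⟩ := q
  have hw0 : w ≠ 0 := fun h => by rw [h, norm_zero] at hw; norm_num at hw
  have hunit : ‖nrm (toC w)‖ = 1 := norm_nrm (IwasePolar.toC_ne_zero_of_ne_zero hw0)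
  rw [IwasePolar.polarMapInv, gluckMap_eq_of_ne_zero (p := (p, w)) hw0, Prod.mk.injEq]
  refine ⟨?_, rfl⟩
  simp only
  rw [IwasePolar.polS, IwasePolar.pol_eq_of_muP_eq_one (by rwa [norm_toC]) hμ, inv_inv,
    IwasePolar.circleOf_nrm_toC hw0]

/-- **The inverse polar map is the Gluck map where the profile vanishes.** [folklore] -/
theorem polarMapInv_eq_gluckMap_of_gprof {q : sphere (0 : EuclideanSpace ℝ (Fin 3)) 1 ×
    EuclideanSpace ℝ (Fin 2)} (hx : IwasePolar.gprof (IwasePolar.xsq q.1) = 0) (hw : q.2 ≠ 0) :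
    IwasePolar.polarMapInv q = gluckMap q := by
  obtain ⟨p, w⟩ := q
  rw [IwasePolar.polarMapInv, gluckMap_eq_of_ne_zero (p := (p, w)) hw, Prod.mk.injEq]
  refine ⟨?_, rfl⟩
  simp only
  rw [IwasePolar.polS, IwasePolar.pol_eq_of_gprof_eq_zero hx, inv_inv, IwasePolar.circleOf_nrm_toC hw]

/-! ### The regions -/

/-- **The polar region** `N = {‖w‖ < 197/200}`. [folklore] -/
def Nset : Set (sphere (0 : EuclideanSpace ℝ (Fin 3)) 1 × EuclideanSpace ℝ (Fin 2)) :=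
  {q | ‖q.2‖ < 197 / 200}

/-- The polar region is open. [folklore] -/
theorem isOpen_Nset : IsOpen Nset := isOpen_lt (continuous_norm.comp continuous_snd) continuous_const

/-- **The polar part of the torus**: `w = g(x)` (as a complex number) inside `N`. [folklore] -/
def SigmaN : Set (sphere (0 : EuclideanSpace ℝ (Fin 3)) 1 × EuclideanSpace ℝ (Fin 2)) :=
  {q | ‖q.2‖ < 197 / 200 ∧ toC q.2 = ↑(IwasePolar.gprof (IwasePolar.xsq q.1))}

/-- **The handle part of the torus**: the image of the core `{‖ζ‖ = 1, c = 0}` of the box.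
[folklore] -/
def SigmaH : Set (sphere (0 : EuclideanSpace ℝ (Fin 3)) 1 × EuclideanSpace ℝ (Fin 2)) :=
  handleMap '' {u | u ∈ Ubox ∧ u.2 ∈ UnknotSurgery.unknot}

/-- **The singular torus of `Φ`.** [folklore] -/
def Sigma0 : Set (sphere (0 : EuclideanSpace ℝ (Fin 3)) 1 × EuclideanSpace ℝ (Fin 2)) :=
  SigmaN ∪ SigmaH

/-- **The singular torus of `Ψ`** (the image side). [folklore] -/
def Sigma1 : Set (sphere (0 : EuclideanSpace ℝ (Fin 3)) 1 × EuclideanSpace ℝ (Fin 2)) :=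
  SigmaN ∪ gluckMapInv '' SigmaH

/-- For a handle point, being on the handle torus means that `h⁻¹` lands on the core.
[folklore] -/
theorem mem_SigmaH_iff {q : sphere (0 : EuclideanSpace ℝ (Fin 3)) 1 × EuclideanSpace ℝ (Fin 2)}
    (hq : q ∈ Hset) : q ∈ SigmaH ↔ (handleInv q).2 ∈ UnknotSurgery.unknot := by
  constructor
  · rintro ⟨u, ⟨hu, hc⟩, rfl⟩
    rwa [handleInv_handleMap_of_mem hu]
  · intro h
    exact ⟨handleInv q, ⟨handleInv_mem_Ubox hq, h⟩, handleMap_handleInv_of_mem hq⟩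

/-- The handle torus lies in the handle. [folklore] -/
theorem SigmaH_subset : SigmaH ⊆ Hset := by
  rintro _ ⟨u, ⟨hu, _⟩, rfl⟩; exact handleMap_mem_Hset hu

/-- **The handle off the core** `H' = {q ∈ H : h⁻¹ q ∉ core}`. [folklore] -/
def Hoff : Set (sphere (0 : EuclideanSpace ℝ (Fin 3)) 1 × EuclideanSpace ℝ (Fin 2)) :=
  {q | q ∈ Hset ∧ (handleInv q).2 ∉ UnknotSurgery.unknot}

/-- The core `{‖ζ‖ = 1, c = 0}` is closed. [folklore] -/
theorem isClosed_unknot : IsClosed UnknotSurgery.unknot := by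
  have : UnknotSurgery.unknot = (fun p : ℂ × ℝ => (‖p.1‖, p.2)) ⁻¹' {(1, 0)} := by
    ext p; simp [UnknotSurgery.unknot, Prod.ext_iff]
  rw [this]
  exact isClosed_singleton.preimage ((continuous_norm.comp continuous_fst).prodMk continuous_snd)

/-- The handle off the core is open. [folklore] -/
theorem isOpen_Hoff : IsOpen Hoff := by
  rw [isOpen_iff_mem_nhds]
  rintro q ⟨hq, hc⟩
  have e1 : ∀ᶠ q' in 𝓝 q, q' ∈ Hset := isOpen_Hset.mem_nhds hq
  have e2 : ∀ᶠ q' in 𝓝 q, (handleInv q').2 ∉ UnknotSurgery.unknot :=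
    (continuousAt_snd.comp (contMDiffAt_handleInv_of_mem hq).continuousAt).preimage_mem_nhds
      (isClosed_unknot.isOpen_compl.mem_nhds hc)
  filter_upwards [e1, e2] with q' a1 a2
  exact ⟨a1, a2⟩

/-- `H' = H ∖ Σ_H`. [folklore] -/
theorem mem_Hoff_iff {q : sphere (0 : EuclideanSpace ℝ (Fin 3)) 1 × EuclideanSpace ℝ (Fin 2)} :
    q ∈ Hoff ↔ q ∈ Hset ∧ q ∉ SigmaH := by
  constructor
  · rintro ⟨hq, hc⟩; exact ⟨hq, fun h => hc ((mem_SigmaH_iff hq).1 h)⟩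
  · rintro ⟨hq, hc⟩; exact ⟨hq, fun h => hc ((mem_SigmaH_iff hq).2 h)⟩

/-! ### The handle torus inside the band is the polar torus -/

/-- A core point of the band is on the polar torus: `h(s, ζ, 0)` with `‖ζ‖ = 1`, `s ≤ 1/500`
has `x = K(s) = 1 - r` and `w = r > 0` real, so `w = g(x)`. [folklore] -/
theorem core_band_polar {s : ℝ} {ζ : ℂ} {c : ℝ} (hu : ((s, ζ, c) : ℝ × ℂ × ℝ) ∈ Ubox)
    (hs : s ≤ 1 / 500) (hcore : ((ζ, c) : ℂ × ℝ) ∈ UnknotSurgery.unknot) :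
    toC (handleMap (s, ζ, c)).2 = ↑(IwasePolar.gprof (IwasePolar.xsq (handleMap (s, ζ, c)).1)) := by
  obtain ⟨hs01, hζ, _⟩ := Ubox_aux hu
  obtain ⟨h1, h2⟩ := hcore
  simp only at h1 h2
  subst h2
  have hs0 := hs01.1
  have hs10 : s ≤ 1 / 10 := by linarith
  have hK := Kfun_eq_of_le hs0 hs
  have htan0 : 0 ≤ tan (π * s) := by
    have hπ3 : 3 < π := pi_gt_three
    exact tan_nonneg_of_nonneg_of_le_pi_div_two (by positivity) (by nlinarith [pi_pos])
  rw [xsq_handleMap_of_le hs0 hs10 hζ, kfun_sq, h1, one_pow, mul_one, handleMap_snd_of_le hs0 hs10 hζ,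
    toC_wOf, IwasePolar.gprof_of_le (by rw [hK]; linarith), hK]
  simp only [Complex.ofReal_zero, zero_mul, Complex.exp_zero, mul_one]
  push_cast
  ring

/-- **On the handle ∩ band, the polar torus is the handle core**: a handle point with
`‖w‖ < 197/200` lies on the polar torus `w = g(x)` iff `h⁻¹` lands on the core. [folklore] -/
theorem polar_iff_core {q : sphere (0 : EuclideanSpace ℝ (Fin 3)) 1 × EuclideanSpace ℝ (Fin 2)}
    (hq : q ∈ Hset) (hN : ‖q.2‖ < 197 / 200) :
    toC q.2 = ↑(IwasePolar.gprof (IwasePolar.xsq q.1)) ↔ (handleInv q).2 ∈ UnknotSurgery.unknot := by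
  have hq' : q ∈ handleMap '' Ubox := by rw [image_handleMap_Ubox]; exact hq
  obtain ⟨⟨s, ζ, c⟩, hu, rfl⟩ := hq'
  rw [handleInv_handleMap_of_mem hu]
  obtain ⟨hs01, hζ, hc⟩ := Ubox_aux hu
  -- reduce to the northern end by the mirror symmetry
  wlog hsN : s ≤ 1 / 500 generalizing s
  · have hend := end_of_rad_lt hs01 hζ (by rwa [norm_handleMap_snd hs01 hζ] at hN)
    have hsS : 499 / 500 ≤ s := hend.resolve_left hsN
    have hu' : ((1 - s, ζ, c) : ℝ × ℂ × ℝ) ∈ Ubox :=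
      ⟨⟨by linarith [hu.1.2], by linarith [hu.1.1]⟩, hu.2.1, hu.2.2⟩
    have hmir : handleMap (s, ζ, c) = (mirrorS2 (handleMap (1 - s, ζ, c)).1,
        (handleMap (1 - s, ζ, c)).2) := by
      rw [← handleMap_one_sub, sub_sub_cancel]
    have key := this (1 - s) hu' (handleMap_mem_Hset hu') (by rw [hmir] at hN; exact hN)
      (Ubox_aux hu').1 (Ubox_aux hu').2.1 (Ubox_aux hu').2.2 (by linarith)
    rw [hmir]
    simpa [xsq_mirrorS2] using key
  -- the northern end
  have hs0 := hs01.1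
  have hs10 : s ≤ 1 / 10 := by linarith
  have hK := Kfun_eq_of_le hs0 hsN
  have htan0 : 0 ≤ tan (π * s) := by
    have hπ3 : 3 < π := pi_gt_three
    exact tan_nonneg_of_nonneg_of_le_pi_div_two (by positivity) (by nlinarith [pi_pos])
  have hKpos := Kfun_pos s
  constructor
  · intro h
    rw [xsq_handleMap_of_le hs0 hs10 hζ, kfun_sq, handleMap_snd_of_le hs0 hs10 hζ, toC_wOf] at h
    set r : ℝ := 49 / 50 + tan (π * s) with hr
    have hr0 : 0 < r := by rw [hr]; linarith
    -- imaginary part: `sin c = 0`, so `c = 0`; real part then gives the modulus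
    have him := congrArg Complex.im h
    have hre := congrArg Complex.re h
    simp only [Complex.ofReal_im, Complex.im_ofReal_mul, Complex.re_ofReal_mul, Complex.ofReal_re,
      Complex.exp_ofReal_mul_I_im, Complex.exp_ofReal_mul_I_re] at him hre
    have hsin : sin c = 0 := (mul_eq_zero.1 him).resolve_left hr0.ne'
    have hc0 : c = 0 := by
      have hπ3 : 3 < π := pi_gt_three
      obtain ⟨h5, h6⟩ := abs_lt.1 hu.2.2
      exact (sin_eq_zero_iff_of_lt_of_lt (by linarith) (by linarith)).1 hsin
    subst hc0
    rw [cos_zero, mul_one] at hre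
    -- now `r = g(K‖ζ‖²)` with `r ≥ 49/50`: forces `K‖ζ‖² ≤ 1/10` and then `K‖ζ‖² = 1 - r = K`
    have hx : Kfun s * ‖ζ‖ ^ 2 ≤ 1 / 10 := by
      by_contra hcon
      push Not at hcon
      rcases le_or_gt (1 / 5) (Kfun s * ‖ζ‖ ^ 2) with h5 | h5
      · rw [IwasePolar.gprof_of_ge h5] at hre; linarith
      · have := IwasePolar.gprof_le (x := Kfun s * ‖ζ‖ ^ 2) (by linarith)
        linarith
    rw [IwasePolar.gprof_of_le hx] at hre
    have hζ1 : ‖ζ‖ ^ 2 = 1 := by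
      have : Kfun s * ‖ζ‖ ^ 2 = Kfun s := by rw [hK] at hre ⊢; linarith
      field_simp at this
      linarith
    refine ⟨?_, rfl⟩
    simpa using (pow_eq_one_iff_of_nonneg (norm_nonneg ζ) two_ne_zero).1 hζ1
  · intro h
    exact core_band_polar hu hsN h

/-- **Off-core band points of the handle are off the polar torus.** [folklore] -/
theorem not_polar_of_Hoff {q : sphere (0 : EuclideanSpace ℝ (Fin 3)) 1 × EuclideanSpace ℝ (Fin 2)}
    (hq : q ∈ Hoff) (hN : ‖q.2‖ < 197 / 200) :
    toC q.2 ≠ ↑(IwasePolar.gprof (IwasePolar.xsq q.1)) := fun h =>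
  hq.2 ((polar_iff_core hq.1 hN).1 h)

/-- The handle torus inside the band is contained in the polar torus. [folklore] -/
theorem SigmaH_band_subset {q : sphere (0 : EuclideanSpace ℝ (Fin 3)) 1 × EuclideanSpace ℝ (Fin 2)}
    (hq : q ∈ SigmaH) (hN : ‖q.2‖ < 197 / 200) : q ∈ SigmaN :=
  ⟨hN, (polar_iff_core (SigmaH_subset hq) hN).2 ((mem_SigmaH_iff (SigmaH_subset hq)).1 hq)⟩

/-- On the handle torus inside the band the inverse Gluck map is the identity (the plane
coordinate `w = r > 0` is a positive real). [folklore] -/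
theorem gluckMapInv_of_SigmaH_band {q : sphere (0 : EuclideanSpace ℝ (Fin 3)) 1 × EuclideanSpace ℝ (Fin 2)}
    (hq : q ∈ SigmaH) (hN : ‖q.2‖ < 197 / 200) : gluckMapInv q = q := by
  obtain ⟨⟨s, ζ, c⟩, ⟨hu, hcore⟩, rfl⟩ := hq
  obtain ⟨hs01, hζ, hc⟩ := Ubox_aux hu
  obtain ⟨_, hc0⟩ := hcore
  simp only at hc0
  subst hc0
  have hw0 := handleMap_snd_ne_zero hu
  rw [gluckMapInv_eq_of_ne_zero hw0]
  refine Prod.ext ?_ rfl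
  simp only
  -- the plane coordinate is `r • (1, 0)`, whose unit vector is `(1, 0) = circlePoint 0`
  have hr := rad_pos hs01 (neg_one_lt_aOf s hζ)
  have hw : (handleMap (s, ζ, 0)).2 = rad s (aOf s ζ) • ((circlePoint 0 : sphere (0 :
      EuclideanSpace ℝ (Fin 2)) 1) : EuclideanSpace ℝ (Fin 2)) := by
    change wOf (rad s (aOf s ζ)) 0 = _
    rw [wOf]
    ext i
    fin_cases i <;> simp [circlePoint, Complex.exp_zero]
  have hconj : conjCircle (circlePoint 0) = circlePoint 0 := by
    apply Subtype.ext; ext i; fin_cases i <;> simp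
  rw [hw, unitVector₀_smul_coe hr, hconj, rotateSphereTwo_circlePoint_zero]
  rfl

/-! ### The global model maps -/

open Classical in
/-- **The model diffeomorphism `Φ` of `S² × ℝ²`** (off the torus `Σ₀`): the polar model on
`N = {‖w‖ < 197/200}`, the handle model on the handle, the inverse Gluck map elsewhere.
[cite: Iwase1988, proof of Prop. 3.5 (p. 297)] -/
def Phi (q : sphere (0 : EuclideanSpace ℝ (Fin 3)) 1 × EuclideanSpace ℝ (Fin 2)) :
    sphere (0 : EuclideanSpace ℝ (Fin 3)) 1 × EuclideanSpace ℝ (Fin 2) :=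
  if ‖q.2‖ < 197 / 200 then IwasePolar.polarMap q else if q ∈ Hset then PhiH q else gluckMapInv q

open Classical in
/-- **The inverse model map `Ψ`.** [folklore] -/
def Psi (q : sphere (0 : EuclideanSpace ℝ (Fin 3)) 1 × EuclideanSpace ℝ (Fin 2)) :
    sphere (0 : EuclideanSpace ℝ (Fin 3)) 1 × EuclideanSpace ℝ (Fin 2) :=
  if ‖q.2‖ < 197 / 200 then IwasePolar.polarMapInv q
  else if gluckMap q ∈ Hset then PsiH q else gluckMap q

/-- `Φ` on the polar region. [folklore] -/
theorem Phi_of_N {q : sphere (0 : EuclideanSpace ℝ (Fin 3)) 1 × EuclideanSpace ℝ (Fin 2)}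
    (h : ‖q.2‖ < 197 / 200) : Phi q = IwasePolar.polarMap q := by
  simp [Phi, h]

/-- `Φ` on the handle outside the polar region. [folklore] -/
theorem Phi_of_H {q : sphere (0 : EuclideanSpace ℝ (Fin 3)) 1 × EuclideanSpace ℝ (Fin 2)}
    (h : ¬‖q.2‖ < 197 / 200) (hq : q ∈ Hset) : Phi q = PhiH q := by
  simp [Phi, h, hq]

/-- `Φ` on the exterior. [folklore] -/
theorem Phi_of_ext {q : sphere (0 : EuclideanSpace ℝ (Fin 3)) 1 × EuclideanSpace ℝ (Fin 2)}
    (h : ¬‖q.2‖ < 197 / 200) (hq : q ∉ Hset) : Phi q = gluckMapInv q := by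
  simp [Phi, h, hq]

/-- `Ψ` on the polar region. [folklore] -/
theorem Psi_of_N {q : sphere (0 : EuclideanSpace ℝ (Fin 3)) 1 × EuclideanSpace ℝ (Fin 2)}
    (h : ‖q.2‖ < 197 / 200) : Psi q = IwasePolar.polarMapInv q := by
  simp [Psi, h]

/-- `Ψ` on the Gluck preimage of the handle outside the polar region. [folklore] -/
theorem Psi_of_H {q : sphere (0 : EuclideanSpace ℝ (Fin 3)) 1 × EuclideanSpace ℝ (Fin 2)}
    (h : ¬‖q.2‖ < 197 / 200) (hq : gluckMap q ∈ Hset) : Psi q = PsiH q := by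
  simp [Psi, h, hq]

/-- `Ψ` on the exterior. [folklore] -/
theorem Psi_of_ext {q : sphere (0 : EuclideanSpace ℝ (Fin 3)) 1 × EuclideanSpace ℝ (Fin 2)}
    (h : ¬‖q.2‖ < 197 / 200) (hq : gluckMap q ∉ Hset) : Psi q = gluckMap q := by
  simp [Psi, h, hq]

/-- **On the handle off the core, `Φ = Φ_H`** (by the agreement with the polar model on the
band). [folklore] -/
theorem Phi_of_Hoff {q : sphere (0 : EuclideanSpace ℝ (Fin 3)) 1 × EuclideanSpace ℝ (Fin 2)}
    (hq : q ∈ Hoff) : Phi q = PhiH q := by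
  by_cases h : ‖q.2‖ < 197 / 200
  · rw [Phi_of_N h, PhiH_eq_polarMap hq.1 h hq.2]
  · exact Phi_of_H h hq.1

/-- `Φ` preserves the plane coordinate's norm being `< 197/200` or not... more precisely: `Φ`
maps the polar region to itself. [folklore] -/
theorem Phi_snd_of_N {q : sphere (0 : EuclideanSpace ℝ (Fin 3)) 1 × EuclideanSpace ℝ (Fin 2)}
    (h : ‖q.2‖ < 197 / 200) : (Phi q).2 = q.2 := by
  rw [Phi_of_N h, IwasePolar.polarMap_snd]

/-- `Ψ` maps the polar region to itself. [folklore] -/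
theorem Psi_snd_of_N {q : sphere (0 : EuclideanSpace ℝ (Fin 3)) 1 × EuclideanSpace ℝ (Fin 2)}
    (h : ‖q.2‖ < 197 / 200) : (Psi q).2 = q.2 := by
  rw [Psi_of_N h, IwasePolar.polarMapInv_snd]

/-- Outside the polar region `Φ` stays outside. [folklore] -/
theorem not_lt_Phi_snd {q : sphere (0 : EuclideanSpace ℝ (Fin 3)) 1 × EuclideanSpace ℝ (Fin 2)}
    (h : ¬‖q.2‖ < 197 / 200) : ¬‖(Phi q).2‖ < 197 / 200 := by
  by_cases hq : q ∈ Hset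
  · rw [Phi_of_H h hq, norm_PhiH_snd_lt_iff hq]; exact h
  · rw [Phi_of_ext h hq, gluckMapInv_snd]; exact h

/-- Outside the polar region `Ψ` stays outside. [folklore] -/
theorem not_lt_Psi_snd {q : sphere (0 : EuclideanSpace ℝ (Fin 3)) 1 × EuclideanSpace ℝ (Fin 2)}
    (h : ¬‖q.2‖ < 197 / 200) : ¬‖(Psi q).2‖ < 197 / 200 := by
  by_cases hq : gluckMap q ∈ Hset
  · rw [Psi_of_H h hq, norm_PsiH_snd_lt_iff hq]; exact h
  · rw [Psi_of_ext h hq, gluckMap_snd]; exact h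

/-! ### `Φ` and `Ψ` are mutually inverse off the tori -/

/-- A point outside the polar region has `w ≠ 0`. [folklore] -/
theorem snd_ne_zero_of_not_lt {q : sphere (0 : EuclideanSpace ℝ (Fin 3)) 1 × EuclideanSpace ℝ (Fin 2)}
    (h : ¬‖q.2‖ < 197 / 200) : q.2 ≠ 0 := by
  intro h0; apply h; rw [h0, norm_zero]; norm_num

/-- **`Ψ ∘ Φ = id` off `Σ₀`, and `Φ` maps `Σ₀ᶜ` into `Σ₁ᶜ`.** [folklore] -/
theorem Psi_Phi {q : sphere (0 : EuclideanSpace ℝ (Fin 3)) 1 × EuclideanSpace ℝ (Fin 2)}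
    (hq : q ∉ Sigma0) : Phi q ∉ Sigma1 ∧ Psi (Phi q) = q := by
  have hqN : q ∉ SigmaN := fun h => hq (Or.inl h)
  have hqH : q ∉ SigmaH := fun h => hq (Or.inr h)
  by_cases hN : ‖q.2‖ < 197 / 200
  · -- polar region
    have hwg : toC q.2 ≠ ↑(IwasePolar.gprof (IwasePolar.xsq q.1)) := fun h => hqN ⟨hN, h⟩
    have h1 : Phi q = IwasePolar.polarMap q := Phi_of_N hN
    have hN' : ‖(Phi q).2‖ < 197 / 200 := by rwa [Phi_snd_of_N hN]
    refine ⟨?_, ?_⟩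
    · rintro (h | h)
      · apply hwg
        have := h.2
        rwa [h1, IwasePolar.polarMap_snd, IwasePolar.xsq_polarMap_fst] at this
      · obtain ⟨p, hp, hpq⟩ := h
        have hpN : ‖p.2‖ < 197 / 200 := by
          have := congrArg (fun z => ‖z.2‖) hpq
          simp only [gluckMapInv_snd] at this
          rwa [this]
        have hpS := SigmaH_band_subset hp hpN
        rw [gluckMapInv_of_SigmaH_band hp hpN] at hpq
        apply hwg
        have := hpS.2
        rwa [hpq, h1, IwasePolar.polarMap_snd, IwasePolar.xsq_polarMap_fst] at this
    · rw [Psi_of_N hN', h1]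
      exact IwasePolar.polarMapInv_polarMap (by linarith) (by exact_mod_cast hwg)
  · have hN' := not_lt_Phi_snd (q := q) hN
    by_cases hH : q ∈ Hset
    · -- handle
      have hoff : q ∈ Hoff := mem_Hoff_iff.2 ⟨hH, hqH⟩
      have h1 : Phi q = PhiH q := Phi_of_H hN hH
      have hG : gluckMap (Phi q) ∈ Hset := by rw [h1]; exact gluckMap_PhiH_mem hH
      refine ⟨?_, ?_⟩
      · rintro (h | ⟨p, hp, hpq⟩)
        · exact hN' h.1
        · -- `G⁻¹ p = Φ_H q` with `p` on the core: apply `G` and `h⁻¹`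
          have hp0 : p.2 ≠ 0 := snd_ne_zero_of_mem_Hset (SigmaH_subset hp)
          have := congrArg gluckMap hpq
          rw [gluckMap_gluckMapInv hp0, h1, gluckMap_PhiH hH] at this
          -- `p = h (Θ̂ (h⁻¹ q))`, so `h⁻¹ p = Θ̂ (h⁻¹ q)` is off the core
          have hc : (handleInv p).2 ∈ UnknotSurgery.unknot := (mem_SigmaH_iff (SigmaH_subset hp)).1 hp
          rw [this, handleInv_handleMap_of_mem (ThetaS_mem_Ubox (handleInv_mem_Ubox hH))] at hc
          exact ThetaS_not_mem hoff.2 hc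
      · rw [Psi_of_H hN' hG, h1]
        exact PsiH_PhiH hH hoff.2
    · -- exterior
      have h1 : Phi q = gluckMapInv q := Phi_of_ext hN hH
      have hq0 := snd_ne_zero_of_not_lt hN
      have hG : gluckMap (Phi q) = q := by rw [h1, gluckMap_gluckMapInv hq0]
      refine ⟨?_, ?_⟩
      · rintro (h | ⟨p, hp, hpq⟩)
        · exact hN' h.1
        · have hp0 : p.2 ≠ 0 := snd_ne_zero_of_mem_Hset (SigmaH_subset hp)
          have := congrArg gluckMap hpq
          rw [gluckMap_gluckMapInv hp0, hG] at this
          exact hH (this ▸ SigmaH_subset hp)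
      · rw [Psi_of_ext hN' (by rw [hG]; exact hH), hG]

/-- **`Φ ∘ Ψ = id` off `Σ₁`, and `Ψ` maps `Σ₁ᶜ` into `Σ₀ᶜ`.** [folklore] -/
theorem Phi_Psi {q : sphere (0 : EuclideanSpace ℝ (Fin 3)) 1 × EuclideanSpace ℝ (Fin 2)}
    (hq : q ∉ Sigma1) : Psi q ∉ Sigma0 ∧ Phi (Psi q) = q := by
  have hqN : q ∉ SigmaN := fun h => hq (Or.inl h)
  have hqH : q ∉ gluckMapInv '' SigmaH := fun h => hq (Or.inr h)
  by_cases hN : ‖q.2‖ < 197 / 200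
  · have hwg : toC q.2 ≠ ↑(IwasePolar.gprof (IwasePolar.xsq q.1)) := fun h => hqN ⟨hN, h⟩
    have h1 : Psi q = IwasePolar.polarMapInv q := Psi_of_N hN
    have hN' : ‖(Psi q).2‖ < 197 / 200 := by rwa [Psi_snd_of_N hN]
    have hxw : toC (Psi q).2 ≠ ↑(IwasePolar.gprof (IwasePolar.xsq (Psi q).1)) := by
      rw [h1, IwasePolar.polarMapInv_snd, IwasePolar.polarMapInv, IwasePolar.xsq_rotateSphereTwo]
      exact hwg
    refine ⟨?_, ?_⟩
    · rintro (h | h)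
      · exact hxw h.2
      · exact hxw (SigmaH_band_subset h hN').2
    · rw [Phi_of_N hN', h1]
      exact IwasePolar.polarMap_polarMapInv (by linarith) (by exact_mod_cast hwg)
  · have hN' := not_lt_Psi_snd (q := q) hN
    have hq0 := snd_ne_zero_of_not_lt hN
    by_cases hH : gluckMap q ∈ Hset
    · have hc : (handleInv (gluckMap q)).2 ∉ UnknotSurgery.unknot := by
        intro h
        apply hqH
        refine ⟨gluckMap q, (mem_SigmaH_iff hH).2 h, gluckMapInv_gluckMap hq0⟩
      have h1 : Psi q = PsiH q := Psi_of_H hN hH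
      have hmem : Psi q ∈ Hset := by rw [h1]; exact PsiH_mem hH
      have hoff : Psi q ∈ Hoff := by
        refine ⟨hmem, ?_⟩
        rw [h1, PsiH, handleInv_handleMap_of_mem (ThetaSInv_mem_Ubox (handleInv_mem_Ubox hH))]
        exact ThetaSInv_not_mem hc
      refine ⟨?_, ?_⟩
      · rintro (h | h)
        · exact hN' h.1
        · exact (mem_Hoff_iff.1 hoff).2 h
      · rw [Phi_of_H hN' hmem, h1]
        exact PhiH_PsiH hH hc hq0
    · have h1 : Psi q = gluckMap q := Psi_of_ext hN hH
      refine ⟨?_, ?_⟩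
      · rintro (h | h)
        · exact hN' h.1
        · exact hH (h1 ▸ SigmaH_subset h)
      · rw [Phi_of_ext hN' (by rw [h1]; exact hH), h1, gluckMapInv_gluckMap hq0]

/-! ### The far field -/

/-- The vertical factor is at most `9/4`. [folklore] -/
theorem mfac_le (X : ℝ) : mfac X ≤ 9 / 4 := by
  by_cases h5 : X ^ 2 ≤ 1 / 5
  · rw [mfac_eq_one h5]; norm_num
  · push Not at h5
    obtain ⟨h0, h1⟩ := lam_mem X
    have hXpos : 0 < |X| := abs_pos.2 fun h => by rw [h] at h5; norm_num at h5
    have hinv : (Real.sqrt (X ^ 2))⁻¹ ≤ 9 / 4 := by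
      rw [Real.sqrt_sq_eq_abs, inv_le_comm₀ hXpos (by norm_num)]
      have : (4 / 9 : ℝ) ^ 2 < |X| ^ 2 := by rw [sq_abs]; linarith
      nlinarith [abs_nonneg X]
    unfold mfac
    nlinarith [inv_nonneg.2 (Real.sqrt_nonneg (X ^ 2))]

/-- The handle stays below height `4`: `r < 4` on the box. [folklore] -/
theorem rad_lt_four {s a : ℝ} (hs : s ∈ Icc (0 : ℝ) 1) (ha : |a| ≤ 3 / 10) : rad s a < 4 := by
  obtain ⟨ha1, ha2⟩ := abs_le.1 ha
  have hY : (bentStrip (s, a)).2 ≤ 3 := by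
    simp only [bentStrip, hScale, vScale, polarMap]
    have h1 := mfac_le (-(1 + a) * cos (π * s))
    have h2 : (1 + a) * sin (π * s) ≤ 13 / 10 := by nlinarith [sin_le_one (π * s)]
    have h3 : 0 ≤ (1 + a) * sin (π * s) := mul_nonneg (by linarith)
      (sin_nonneg_of_nonneg_of_le_pi (by nlinarith [pi_pos, hs.1]) (by nlinarith [pi_pos, hs.2]))
    nlinarith [(mfac_pos (-(1 + a) * cos (π * s))).le]
  rw [rad]; linarith

/-- Handle points have `‖w‖ < 4`. [folklore] -/
theorem norm_snd_lt_four_of_mem_Hset {q : sphere (0 : EuclideanSpace ℝ (Fin 3)) 1 × EuclideanSpace ℝ (Fin 2)}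
    (hq : q ∈ Hset) : ‖q.2‖ < 4 := by
  have hq' : q ∈ handleMap '' Ubox := by rw [image_handleMap_Ubox]; exact hq
  obtain ⟨⟨s, ζ, c⟩, hu, rfl⟩ := hq'
  obtain ⟨hs01, hζ, _⟩ := Ubox_aux hu
  rw [norm_handleMap_snd hs01 hζ]
  exact rad_lt_four hs01 (abs_aOf_le s hζ)

/-- **Far from the sphere `Φ` is the inverse Gluck map**: `Φ (p, w) = G⁻¹ (p, w)` for `‖w‖ ≥ 4`.
[folklore] -/
theorem Phi_far {q : sphere (0 : EuclideanSpace ℝ (Fin 3)) 1 × EuclideanSpace ℝ (Fin 2)}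
    (hq : 4 ≤ ‖q.2‖) : Phi q = gluckMapInv q :=
  Phi_of_ext (by linarith) fun h => by linarith [norm_snd_lt_four_of_mem_Hset h]

/-! ### Smoothness of `Φ` and `Ψ` -/

/-- The parameter value `s*` of the boundary slice `r = 197/200`: `tan (π s*) = 1/200`.
[folklore] -/
def sStar : ℝ := arctan (1 / 200) / π

/-- `tan (π s*) = 1/200`. [folklore] -/
theorem tan_sStar : tan (π * sStar) = 1 / 200 := by
  rw [sStar, mul_div_cancel₀ _ pi_pos.ne', tan_arctan]

/-- `0 < s* ≤ 1/500`. [folklore] -/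
theorem sStar_mem : 0 < sStar ∧ sStar ≤ 1 / 500 := by
  have hπ3 : 3 < π := pi_gt_three
  have ha : 0 < arctan (1 / 200 : ℝ) := by
    rw [← arctan_zero]; exact arctan_strictMono (by norm_num)
  have hs0 : 0 < sStar := div_pos ha pi_pos
  refine ⟨hs0, ?_⟩
  have h1 : π * sStar < π / 2 := by
    rw [sStar, mul_div_cancel₀ _ pi_pos.ne']; exact arctan_lt_pi_div_two _
  have h2 := Real.le_tan (x := π * sStar) (by positivity) h1
  rw [tan_sStar] at h2
  nlinarith

/-- `K(s*) = 3/200` and `49/50 + tan (π s*) = 197/200`. [folklore] -/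
theorem Kfun_sStar : Kfun sStar = 3 / 200 := by
  rw [Kfun_eq_of_le sStar_mem.1.le sStar_mem.2, tan_sStar]; norm_num

/-- **Boundary points of the polar region with small slice radius are on the handle**: if
`‖w‖ = 197/200` and `x/(3/200) + (arg w)² ≤ 5` then `(p, w) ∈ H`. [folklore] -/
theorem mem_Hset_of_boundary {q : sphere (0 : EuclideanSpace ℝ (Fin 3)) 1 × EuclideanSpace ℝ (Fin 2)}
    (hr : ‖q.2‖ = 197 / 200)
    (h5 : IwasePolar.xsq q.1 / (3 / 200) + (Complex.arg (toC q.2)) ^ 2 ≤ 5) : q ∈ Hset := by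
  obtain ⟨P, w⟩ := q
  simp only at hr h5
  -- reduce to the northern hemisphere by the mirror symmetry
  wlog hnorth : 0 < (P : EuclideanSpace ℝ (Fin 3)) 2 generalizing P
  · have hx := IwasePolar.xsq_nonneg P
    have hx1 : IwasePolar.xsq P ≤ 3 / 40 := by
      have : IwasePolar.xsq P / (3 / 200) ≤ 5 := by nlinarith [sq_nonneg (Complex.arg (toC w))]
      rw [div_le_iff₀ (by norm_num)] at this
      linarith
    have hP2 : (P : EuclideanSpace ℝ (Fin 3)) 2 ≠ 0 := by
      intro h0
      have := sphere_coord_sq_sum P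
      rw [h0, IwasePolar.xsq_eq] at *
      nlinarith
    have hlt : (P : EuclideanSpace ℝ (Fin 3)) 2 < 0 := lt_of_le_of_ne (not_lt.1 hnorth) hP2
    have key := this (mirrorS2 P) (by rwa [xsq_mirrorS2]) (by simp; linarith)
    have := mirror_mem_Hset key
    simpa using this
  -- the northern case: exhibit the box point
  obtain ⟨hs0, hs1⟩ := sStar_mem
  obtain ⟨k, hk⟩ : ∃ k : ℝ, k = kfun sStar := ⟨_, rfl⟩
  have hkpos : 0 < k := by rw [hk]; exact kfun_pos sStar
  have hK : k ^ 2 = 3 / 200 := by rw [hk, kfun_sq, Kfun_sStar]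
  obtain ⟨ζ, hζ⟩ : ∃ ζ : ℂ, ζ = (↑k)⁻¹ * IwasePolar.ycoord P := ⟨_, rfl⟩
  have hkζ : ↑k * ζ = IwasePolar.ycoord P := by
    rw [hζ, ← mul_assoc, mul_inv_cancel₀ (Complex.ofReal_ne_zero.2 hkpos.ne'), one_mul]
  have hζn : ‖ζ‖ ^ 2 = IwasePolar.xsq P / (3 / 200) := by
    rw [hζ, norm_mul, norm_inv, Complex.norm_real, Real.norm_of_nonneg hkpos.le, mul_pow, inv_pow,
      hK, IwasePolar.xsq]
    field_simp
  have hζsq : ‖ζ‖ ^ 2 ≤ 5 := by rw [hζn]; nlinarith [sq_nonneg (Complex.arg (toC w))]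
  have hζlt : ‖ζ‖ < 23 / 10 := by
    have h := abs_lt_of_sq_lt_sq (show ‖ζ‖ ^ 2 < (23 / 10) ^ 2 by linarith) (by norm_num)
    rwa [abs_of_nonneg (norm_nonneg ζ)] at h
  have hcsq : (Complex.arg (toC w)) ^ 2 ≤ 5 := by
    have : 0 ≤ IwasePolar.xsq P / (3 / 200) := div_nonneg (IwasePolar.xsq_nonneg P) (by norm_num)
    linarith
  have hclt : |Complex.arg (toC w)| < 23 / 10 := abs_lt_of_sq_lt_sq (by linarith) (by norm_num)
  have hu : ((sStar, ζ, Complex.arg (toC w)) : ℝ × ℂ × ℝ) ∈ Ubox := ⟨⟨hs0, by linarith⟩, hζlt, hclt⟩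
  have hs10 : sStar ≤ 1 / 10 := by linarith
  have hζ52 : ‖ζ‖ ≤ 5 / 2 := by linarith [hζlt.le]
  have heq : handleMap (sStar, ζ, Complex.arg (toC w)) = (P, w) := by
    refine Prod.ext ?_ ?_
    · apply Subtype.ext
      rw [handleMap_coe_fst_of_le hs0.le hs10 hζ52, ← hk]
      have hre : k * ζ.re = (P : EuclideanSpace ℝ (Fin 3)) 0 := by
        have := congrArg Complex.re hkζ
        simpa [IwasePolar.ycoord] using this
      have him : k * ζ.im = (P : EuclideanSpace ℝ (Fin 3)) 1 := by
        have := congrArg Complex.im hkζ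
        simpa [IwasePolar.ycoord] using this
      have h3 : Real.sqrt (1 - k ^ 2 * ‖ζ‖ ^ 2) = (P : EuclideanSpace ℝ (Fin 3)) 2 := by
        have hx : k ^ 2 * ‖ζ‖ ^ 2 = IwasePolar.xsq P := by
          rw [IwasePolar.xsq, ← hkζ, norm_mul, Complex.norm_real, Real.norm_of_nonneg hkpos.le]
          ring
        rw [hx, IwasePolar.xsq_eq, show 1 - ((P : EuclideanSpace ℝ (Fin 3)) 0 ^ 2 +
            (P : EuclideanSpace ℝ (Fin 3)) 1 ^ 2) = (P : EuclideanSpace ℝ (Fin 3)) 2 ^ 2 by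
          linear_combination (-1 : ℝ) * sphere_coord_sq_sum P, Real.sqrt_sq hnorth.le]
      ext i
      fin_cases i
      · simpa using hre
      · simpa using him
      · simpa using h3
    · show wOf (rad sStar (aOf sStar ζ)) (Complex.arg (toC w)) = w
      rw [rad_eq_of_le hs0.le hs10 (abs_aOf_le sStar hζ52), tan_sStar,
        show (49 / 50 : ℝ) + 1 / 200 = ‖w‖ by rw [hr]; norm_num, wOf_norm_arg]
  rw [← image_handleMap_Ubox]
  exact ⟨_, hu, heq⟩

/-- Contrapositive form: an exterior point on the boundary slice has large slice radius.
[folklore] -/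
theorem five_lt_of_not_mem_Hset {q : sphere (0 : EuclideanSpace ℝ (Fin 3)) 1 × EuclideanSpace ℝ (Fin 2)}
    (hq : q ∉ Hset) (hr : ‖q.2‖ = 197 / 200) :
    5 < IwasePolar.xsq q.1 / (3 / 200) + (Complex.arg (toC q.2)) ^ 2 := by
  by_contra h
  push Not at h
  exact hq (mem_Hset_of_boundary hr h)

/-- **Near an exterior point, the slice cut-off of the polar model is complete on `N`.**
[folklore] -/
theorem muP_eq_one_eventually {q : sphere (0 : EuclideanSpace ℝ (Fin 3)) 1 × EuclideanSpace ℝ (Fin 2)}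
    (hN : ¬‖q.2‖ < 197 / 200)
    (h5 : ‖q.2‖ = 197 / 200 → 5 < IwasePolar.xsq q.1 / (3 / 200) + (Complex.arg (toC q.2)) ^ 2) :
    ∀ᶠ q' in 𝓝 q, ‖q'.2‖ < 197 / 200 →
      IwasePolar.muP (IwasePolar.xsq q'.1) (toC q'.2) = 1 := by
  have hcn : Continuous fun q' : sphere (0 : EuclideanSpace ℝ (Fin 3)) 1 × EuclideanSpace ℝ (Fin 2) =>
      ‖q'.2‖ := continuous_norm.comp continuous_snd
  -- nearby points are above height `49/50`
  have e98 : ∀ᶠ q' : sphere (0 : EuclideanSpace ℝ (Fin 3)) 1 × EuclideanSpace ℝ (Fin 2) in 𝓝 q,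
      49 / 50 < ‖q'.2‖ := hcn.continuousAt.eventually_const_lt (by push Not at hN; linarith)
  rcases (not_lt.1 hN).lt_or_eq with hgt | heq
  · -- strictly outside: nearby points are outside `N`
    have e : ∀ᶠ q' : sphere (0 : EuclideanSpace ℝ (Fin 3)) 1 × EuclideanSpace ℝ (Fin 2) in 𝓝 q,
        197 / 200 < ‖q'.2‖ := hcn.continuousAt.eventually_const_lt hgt
    filter_upwards [e] with q' h1 h2
    exact absurd h2 (not_lt.2 h1.le)
  · have h5' := h5 heq.symm
    have hq0 : q.2 ≠ 0 := snd_ne_zero_of_not_lt hN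
    have hw0 : toC q.2 ≠ 0 := IwasePolar.toC_ne_zero_of_ne_zero hq0
    -- the slice argument exceeds `1` near `q` on `N`
    have einner : ∀ᶠ q' : sphere (0 : EuclideanSpace ℝ (Fin 3)) 1 × EuclideanSpace ℝ (Fin 2) in 𝓝 q,
        ‖q'.2‖ < 197 / 200 → 1 ≤ IwasePolar.inner (IwasePolar.xsq q'.1) (toC q'.2) := by
      by_cases hs : toC q.2 ∈ Complex.slitPlane
      · -- `arg` is continuous at `w`
        have hct : Continuous fun q' : sphere (0 : EuclideanSpace ℝ (Fin 3)) 1 ×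
            EuclideanSpace ℝ (Fin 2) => toC q'.2 := contDiff_toC.continuous.comp continuous_snd
        have harg' := ContinuousAt.comp (f := fun q' : sphere (0 : EuclideanSpace ℝ (Fin 3)) 1 ×
            EuclideanSpace ℝ (Fin 2) => toC q'.2) (x := q) (Complex.continuousAt_arg hs)
          hct.continuousAt
        have harg : ContinuousAt (fun q' : sphere (0 : EuclideanSpace ℝ (Fin 3)) 1 ×
            EuclideanSpace ℝ (Fin 2) => Complex.arg (toC q'.2)) q := harg'
        have hxs : ContinuousAt (fun q' : sphere (0 : EuclideanSpace ℝ (Fin 3)) 1 ×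
            EuclideanSpace ℝ (Fin 2) => IwasePolar.xsq q'.1) q :=
          (IwasePolar.contMDiff_xsq.continuous.comp continuous_fst).continuousAt
        have hden : ContinuousAt (fun q' : sphere (0 : EuclideanSpace ℝ (Fin 3)) 1 ×
            EuclideanSpace ℝ (Fin 2) => 1 - ‖q'.2‖) q := continuousAt_const.sub hcn.continuousAt
        have hne : (fun q' : sphere (0 : EuclideanSpace ℝ (Fin 3)) 1 ×
            EuclideanSpace ℝ (Fin 2) => 1 - ‖q'.2‖) q ≠ 0 := by
          show 1 - ‖q.2‖ ≠ 0
          rw [← heq]; norm_num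
        have hF : ContinuousAt (fun q' : sphere (0 : EuclideanSpace ℝ (Fin 3)) 1 ×
            EuclideanSpace ℝ (Fin 2) => IwasePolar.xsq q'.1 / (1 - ‖q'.2‖) +
              Complex.arg (toC q'.2) ^ 2 - 4) q :=
          ((hxs.div hden hne).add (harg.pow 2)).sub continuousAt_const
        have hval : 1 < IwasePolar.xsq q.1 / (1 - ‖q.2‖) + Complex.arg (toC q.2) ^ 2 - 4 := by
          rw [← heq, show (1 : ℝ) - 197 / 200 = 3 / 200 by norm_num]; linarith
        filter_upwards [hF.eventually_const_lt hval] with q' h1 _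
        rw [IwasePolar.inner, norm_toC]
        exact h1.le
      · -- `w` on the negative real axis: the cone argument
        have hre : (toC q.2).re < 0 := by
          rw [Complex.slitPlane, Set.mem_setOf_eq, not_or, not_lt, not_ne_iff] at hs
          rcases hs.1.lt_or_eq with h | h
          · exact h
          · exact absurd (Complex.ext h hs.2) hw0
        have him : (toC q.2).im = 0 := by
          rw [Complex.slitPlane, Set.mem_setOf_eq, not_or, not_ne_iff] at hs
          exact hs.2
        have hct : Continuous fun q' : sphere (0 : EuclideanSpace ℝ (Fin 3)) 1 ×
            EuclideanSpace ℝ (Fin 2) => toC q'.2 := contDiff_toC.continuous.comp continuous_snd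
        have e1 : ∀ᶠ q' : sphere (0 : EuclideanSpace ℝ (Fin 3)) 1 × EuclideanSpace ℝ (Fin 2) in 𝓝 q,
            (toC q'.2).re < 0 :=
          (Complex.continuous_re.comp hct).continuousAt.eventually_lt continuousAt_const hre
        have e2 : ∀ᶠ q' : sphere (0 : EuclideanSpace ℝ (Fin 3)) 1 × EuclideanSpace ℝ (Fin 2) in 𝓝 q,
            |(toC q'.2).im| < -(toC q'.2).re :=
          (continuous_abs.comp (Complex.continuous_im.comp hct)).continuousAt.eventually_lt
            (Complex.continuous_re.comp hct).neg.continuousAt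
              (by show |(toC q.2).im| < -(toC q.2).re; rw [him, abs_zero]; linarith)
        filter_upwards [e1, e2] with q' h1 h2 h3
        have hw1 : ‖toC q'.2‖ < 1 := by rw [norm_toC]; linarith
        have hx : -(1 - ‖toC q'.2‖) / 2 < IwasePolar.xsq q'.1 := by
          have := IwasePolar.xsq_nonneg q'.1; rw [norm_toC]; linarith
        exact (IwasePolar.one_lt_inner_of_cone h1 h2 hw1 hx).le
    filter_upwards [e98, einner] with q' h1 h2 h3
    rw [IwasePolar.muP_eq_mu1_of_le_inner (h2 h3), IwasePolar.mu1_eq_one]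
    rw [norm_toC]; nlinarith

/-- A sharper small-angle bound: `tan (π t) < 1/200` for `0 ≤ t ≤ 1/1000`. [folklore] -/
theorem tan_lt_of_le {t : ℝ} (ht0 : 0 ≤ t) (ht : t ≤ 1 / 1000) : tan (π * t) < 1 / 200 := by
  have hπ : π < 3.15 := pi_lt_d2
  have hx : π * t ≤ 0.00315 := by nlinarith [pi_pos]
  have hx0 : 0 ≤ π * t := by positivity
  have hcos : 0.99 ≤ cos (π * t) := by
    have h1 := Real.one_sub_sq_div_two_le_cos (x := π * t)
    nlinarith
  have hcpos : 0 < cos (π * t) := by linarith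
  rw [tan_eq_sin_div_cos, div_lt_iff₀ hcpos]
  have := Real.sin_le hx0
  nlinarith

/-- **The compact core block of the handle** `C = h([1/1000, 999/1000] × {‖ζ‖ ≤ 9/4} × {|c| ≤ 9/4})`.
[folklore] -/
def Kc : Set (ℝ × ℂ × ℝ) :=
  Icc (1 / 1000 : ℝ) (999 / 1000) ×ˢ (closedBall (0 : ℂ) (9 / 4) ×ˢ Icc (-(9 / 4) : ℝ) (9 / 4))

/-- The block lies in the box. [folklore] -/
theorem Kc_subset_Ubox : Kc ⊆ Ubox := by
  rintro ⟨s, ζ, c⟩ ⟨⟨hs1, hs2⟩, hζ, hc1, hc2⟩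
  rw [mem_closedBall, dist_zero_right] at hζ
  exact ⟨⟨by linarith, by linarith⟩, by linarith, abs_lt.2 ⟨by linarith, by linarith⟩⟩

/-- The block is compact. [folklore] -/
theorem isCompact_Kc : IsCompact Kc :=
  isCompact_Icc.prod ((isCompact_closedBall _ _).prod isCompact_Icc)

/-- The image of the block is compact. [folklore] -/
theorem isCompact_image_Kc : IsCompact (handleMap '' Kc) := by
  refine isCompact_Kc.image_of_continuousOn fun u hu => (continuousAt_handleMap ?_).continuousWithinAt
  have := (Kc_subset_Ubox hu).2.1; linarith

/-- The image of the block is closed. [folklore] -/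
theorem isClosed_image_Kc : IsClosed (handleMap '' Kc) := isCompact_image_Kc.isClosed

/-- The image of the block lies in the handle. [folklore] -/
theorem image_Kc_subset : handleMap '' Kc ⊆ Hset := by
  rintro _ ⟨u, hu, rfl⟩; exact handleMap_mem_Hset (Kc_subset_Ubox hu)

/-- **Outside the block and outside `N`, the slice cut-off of a handle point is complete.**
[folklore] -/
theorem cutoff_eq_one_of_not_mem_image {q : sphere (0 : EuclideanSpace ℝ (Fin 3)) 1 × EuclideanSpace ℝ (Fin 2)}
    (hq : q ∈ Hset) (hC : q ∉ handleMap '' Kc) (hN : ¬‖q.2‖ < 197 / 200) :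
    cutoff (handleInv q).2 = 1 := by
  have hU := handleInv_mem_Ubox hq
  have hK : handleInv q ∉ Kc := fun h => hC ⟨_, h, handleMap_handleInv_of_mem hq⟩
  obtain ⟨hs01, hζ, hc⟩ := Ubox_aux hU
  set u := handleInv q with hu_def
  have hr : ¬rad u.1 (aOf u.1 u.2.1) < 197 / 200 := by
    rw [← norm_handleMap_snd hs01 hζ u.2.2, show (u.1, u.2.1, u.2.2) = u from rfl, hu_def,
      handleMap_handleInv_of_mem hq]
    exact hN
  -- `s` is not within `1/1000` of an end
  have hs : u.1 ∈ Icc (1 / 1000 : ℝ) (999 / 1000) := by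
    have ha := abs_aOf_le u.1 hζ
    constructor
    · by_contra hcon
      push Not at hcon
      apply hr
      rw [rad_eq_of_le hs01.1 (by linarith) ha]
      linarith [tan_lt_of_le hs01.1 hcon.le]
    · by_contra hcon
      push Not at hcon
      apply hr
      rw [rad_eq_of_ge (by linarith) hs01.2 ha]
      have := tan_lt_of_le (t := 1 - u.1) (by linarith [hs01.2]) (by linarith)
      linarith
  -- hence the slice point is outside the ball or the height interval
  have hout : 9 / 4 < ‖u.2.1‖ ∨ 9 / 4 < |u.2.2| := by
    by_contra hcon
    push Not at hcon
    exact hK ⟨hs, by rw [mem_closedBall, dist_zero_right]; exact hcon.1, abs_le.1 hcon.2⟩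
  apply cutoff_eq_one
  simp only [sqRad]
  rcases hout with h | h
  · nlinarith [sq_nonneg u.2.2, norm_nonneg u.2.1]
  · have : (9 / 4 : ℝ) ^ 2 < u.2.2 ^ 2 := by rw [← sq_abs u.2.2]; nlinarith [abs_nonneg u.2.2]
    nlinarith [norm_nonneg u.2.1]

/-- **Near an exterior point `Φ` is the inverse Gluck map.** [folklore] -/
theorem Phi_eventuallyEq_ext {q : sphere (0 : EuclideanSpace ℝ (Fin 3)) 1 × EuclideanSpace ℝ (Fin 2)}
    (hN : ¬‖q.2‖ < 197 / 200) (hH : q ∉ Hset) : Phi =ᶠ[𝓝 q] gluckMapInv := by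
  have hC : q ∉ handleMap '' Kc := fun h => hH (image_Kc_subset h)
  have eC : ∀ᶠ q' in 𝓝 q, q' ∉ handleMap '' Kc := isClosed_image_Kc.isOpen_compl.mem_nhds hC
  have eμ := muP_eq_one_eventually hN (five_lt_of_not_mem_Hset hH)
  have hcn : Continuous fun q' : sphere (0 : EuclideanSpace ℝ (Fin 3)) 1 × EuclideanSpace ℝ (Fin 2) =>
      ‖q'.2‖ := continuous_norm.comp continuous_snd
  have e85 : ∀ᶠ q' : sphere (0 : EuclideanSpace ℝ (Fin 3)) 1 × EuclideanSpace ℝ (Fin 2) in 𝓝 q,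
      17 / 20 < ‖q'.2‖ :=
    hcn.continuousAt.eventually_const_lt (by push Not at hN; linarith)
  filter_upwards [eC, eμ, e85] with q' h1 h2 h3
  by_cases hN' : ‖q'.2‖ < 197 / 200
  · rw [Phi_of_N hN']
    exact IwasePolar.polarMap_eq_gluckMapInv_of_muP h3.le (h2 hN')
  · by_cases hH' : q' ∈ Hset
    · rw [Phi_of_H hN' hH']
      exact PhiH_eq_gluckMapInv hH' (cutoff_eq_one_of_not_mem_image hH' h1 hN')
    · exact Phi_of_ext hN' hH'

/-- **Near an exterior point `Ψ` is the Gluck map.** [folklore] -/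
theorem Psi_eventuallyEq_ext {q : sphere (0 : EuclideanSpace ℝ (Fin 3)) 1 × EuclideanSpace ℝ (Fin 2)}
    (hN : ¬‖q.2‖ < 197 / 200) (hH : gluckMap q ∉ Hset) : Psi =ᶠ[𝓝 q] gluckMap := by
  have hq0 : q.2 ≠ 0 := snd_ne_zero_of_not_lt hN
  have hG : ContinuousAt gluckMap q :=
    continuousOn_gluckMap.continuousAt ((isOpen_ne_fun continuous_snd continuous_const).mem_nhds hq0)
  have hC : gluckMap q ∉ handleMap '' Kc := fun h => hH (image_Kc_subset h)
  have eC : ∀ᶠ q' in 𝓝 q, gluckMap q' ∉ handleMap '' Kc :=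
    hG.preimage_mem_nhds (isClosed_image_Kc.isOpen_compl.mem_nhds hC)
  have h5 : ‖q.2‖ = 197 / 200 →
      5 < IwasePolar.xsq q.1 / (3 / 200) + (Complex.arg (toC q.2)) ^ 2 := by
    intro hr
    have := five_lt_of_not_mem_Hset hH (by rwa [gluckMap_snd])
    rwa [gluckMap_snd, gluckMap_eq_of_ne_zero hq0, IwasePolar.xsq_rotateSphereTwo] at this
  have eμ := muP_eq_one_eventually hN h5
  have hcn : Continuous fun q' : sphere (0 : EuclideanSpace ℝ (Fin 3)) 1 × EuclideanSpace ℝ (Fin 2) =>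
      ‖q'.2‖ := continuous_norm.comp continuous_snd
  have e85 : ∀ᶠ q' : sphere (0 : EuclideanSpace ℝ (Fin 3)) 1 × EuclideanSpace ℝ (Fin 2) in 𝓝 q,
      17 / 20 < ‖q'.2‖ :=
    hcn.continuousAt.eventually_const_lt (by push Not at hN; linarith)
  filter_upwards [eC, eμ, e85] with q' h1 h2 h3
  by_cases hN' : ‖q'.2‖ < 197 / 200
  · rw [Psi_of_N hN']
    exact polarMapInv_eq_gluckMap_of_muP h3.le (h2 hN')
  · by_cases hH' : gluckMap q' ∈ Hset
    · rw [Psi_of_H hN' hH']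
      exact PsiH_eq_gluckMap hH' (cutoff_eq_one_of_not_mem_image hH' h1 (by rwa [gluckMap_snd]))
    · exact Psi_of_ext hN' hH'

/-- **`Φ` is smooth off `Σ₀`.** [cite: Iwase1988, proof of Prop. 3.5 (p. 297)] -/
theorem contMDiffAt_Phi {q : sphere (0 : EuclideanSpace ℝ (Fin 3)) 1 × EuclideanSpace ℝ (Fin 2)}
    (hq : q ∉ Sigma0) :
    ContMDiffAt ((𝓡 2).prod 𝓘(ℝ, EuclideanSpace ℝ (Fin 2)))
      ((𝓡 2).prod 𝓘(ℝ, EuclideanSpace ℝ (Fin 2))) ∞ Phi q := by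
  have hqN : q ∉ SigmaN := fun h => hq (Or.inl h)
  have hqH : q ∉ SigmaH := fun h => hq (Or.inr h)
  by_cases hN : ‖q.2‖ < 197 / 200
  · have hev : Phi =ᶠ[𝓝 q] IwasePolar.polarMap := by
      filter_upwards [isOpen_Nset.mem_nhds hN] with q' hq'
      exact Phi_of_N hq'
    refine (IwasePolar.contMDiffAt_polarMap (by linarith) ?_).congr_of_eventuallyEq hev
    exact fun h => hqN ⟨hN, h⟩
  · by_cases hH : q ∈ Hset
    · have hoff : q ∈ Hoff := mem_Hoff_iff.2 ⟨hH, hqH⟩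
      have hev : Phi =ᶠ[𝓝 q] PhiH := by
        filter_upwards [isOpen_Hoff.mem_nhds hoff] with q' hq'
        exact Phi_of_Hoff hq'
      exact (contMDiffAt_PhiH hH hoff.2).congr_of_eventuallyEq hev
    · have hq0 := snd_ne_zero_of_not_lt hN
      exact (contMDiffOn_gluckMapInv.contMDiffAt ((isOpen_ne_fun continuous_snd
        continuous_const).mem_nhds hq0)).congr_of_eventuallyEq (Phi_eventuallyEq_ext hN hH)

/-- On the Gluck preimage of the handle off the core, `Ψ = Ψ_H` near the point. [folklore] -/
theorem Psi_eventuallyEq_PsiH {q : sphere (0 : EuclideanSpace ℝ (Fin 3)) 1 × EuclideanSpace ℝ (Fin 2)}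
    (hN : ¬‖q.2‖ < 197 / 200) (hH : gluckMap q ∈ Hset) (hc : (handleInv (gluckMap q)).2 ∉ UnknotSurgery.unknot) :
    Psi =ᶠ[𝓝 q] PsiH := by
  have hq0 : q.2 ≠ 0 := snd_ne_zero_of_not_lt hN
  have hG : ContinuousAt gluckMap q :=
    continuousOn_gluckMap.continuousAt ((isOpen_ne_fun continuous_snd continuous_const).mem_nhds hq0)
  have hoff : gluckMap q ∈ Hoff := ⟨hH, hc⟩
  have e1 : ∀ᶠ q' in 𝓝 q, gluckMap q' ∈ Hoff := hG.preimage_mem_nhds (isOpen_Hoff.mem_nhds hoff)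
  filter_upwards [e1] with q' h1
  by_cases hN' : ‖q'.2‖ < 197 / 200
  · -- in the band: `Ψ = Φ_N⁻¹ = Ψ_H` by the agreement `Φ_H = Φ_N`
    rw [Psi_of_N hN']
    have hq'0 : q'.2 ≠ 0 := by
      have h' := snd_ne_zero_of_mem_Hset h1.1
      rwa [gluckMap_snd] at h'
    have hp : PsiH q' ∈ Hset := PsiH_mem h1.1
    have hpN : ‖(PsiH q').2‖ < 197 / 200 := (norm_PsiH_snd_lt_iff h1.1).2 hN'
    have hpoff : PsiH q' ∈ Hoff := by
      refine ⟨hp, ?_⟩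
      rw [PsiH, handleInv_handleMap_of_mem (ThetaSInv_mem_Ubox (handleInv_mem_Ubox h1.1))]
      exact ThetaSInv_not_mem h1.2
    have key : IwasePolar.polarMap (PsiH q') = q' := by
      rw [← PhiH_eq_polarMap hp hpN hpoff.2]
      exact PhiH_PsiH h1.1 h1.2 hq'0
    have hwg : toC (PsiH q').2 ≠ ↑(IwasePolar.gprof (IwasePolar.xsq (PsiH q').1)) :=
      not_polar_of_Hoff hpoff hpN
    conv_lhs => rw [← key]
    exact IwasePolar.polarMapInv_polarMap (by linarith) hwg
  · exact Psi_of_H hN' h1.1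

/-- **`Ψ` is smooth off `Σ₁`.** [folklore] -/
theorem contMDiffAt_Psi {q : sphere (0 : EuclideanSpace ℝ (Fin 3)) 1 × EuclideanSpace ℝ (Fin 2)}
    (hq : q ∉ Sigma1) :
    ContMDiffAt ((𝓡 2).prod 𝓘(ℝ, EuclideanSpace ℝ (Fin 2)))
      ((𝓡 2).prod 𝓘(ℝ, EuclideanSpace ℝ (Fin 2))) ∞ Psi q := by
  have hqN : q ∉ SigmaN := fun h => hq (Or.inl h)
  have hqH : q ∉ gluckMapInv '' SigmaH := fun h => hq (Or.inr h)
  by_cases hN : ‖q.2‖ < 197 / 200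
  · have hev : Psi =ᶠ[𝓝 q] IwasePolar.polarMapInv := by
      filter_upwards [isOpen_Nset.mem_nhds hN] with q' hq'
      exact Psi_of_N hq'
    refine (contMDiffAt_polarMapInv (by linarith) ?_).congr_of_eventuallyEq hev
    exact fun h => hqN ⟨hN, h⟩
  · have hq0 := snd_ne_zero_of_not_lt hN
    by_cases hH : gluckMap q ∈ Hset
    · have hc : (handleInv (gluckMap q)).2 ∉ UnknotSurgery.unknot := by
        intro h
        exact hqH ⟨gluckMap q, (mem_SigmaH_iff hH).2 h, gluckMapInv_gluckMap hq0⟩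
      exact (contMDiffAt_PsiH hH hc hq0).congr_of_eventuallyEq (Psi_eventuallyEq_PsiH hN hH hc)
    · have hsm : ContMDiffOn ((𝓡 2).prod 𝓘(ℝ, EuclideanSpace ℝ (Fin 2)))
          ((𝓡 2).prod 𝓘(ℝ, EuclideanSpace ℝ (Fin 2))) ∞ gluckMap
          {p : sphere (0 : EuclideanSpace ℝ (Fin 3)) 1 × EuclideanSpace ℝ (Fin 2) | p.2 ≠ 0} :=
        contMDiffOn_gluckMap_holds
      exact (hsm.contMDiffAt ((isOpen_ne_fun continuous_snd continuous_const).mem_nhds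
        hq0)).congr_of_eventuallyEq (Psi_eventuallyEq_ext hN hH)

/-- **`Φ` is smooth on the complement of `Σ₀`.** [folklore] -/
theorem contMDiffOn_Phi : ContMDiffOn ((𝓡 2).prod 𝓘(ℝ, EuclideanSpace ℝ (Fin 2)))
    ((𝓡 2).prod 𝓘(ℝ, EuclideanSpace ℝ (Fin 2))) ∞ Phi Sigma0ᶜ := fun _ hq =>
  (contMDiffAt_Phi hq).contMDiffWithinAt

/-- **`Ψ` is smooth on the complement of `Σ₁`.** [folklore] -/
theorem contMDiffOn_Psi : ContMDiffOn ((𝓡 2).prod 𝓘(ℝ, EuclideanSpace ℝ (Fin 2)))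
    ((𝓡 2).prod 𝓘(ℝ, EuclideanSpace ℝ (Fin 2))) ∞ Psi Sigma1ᶜ := fun _ hq =>
  (contMDiffAt_Psi hq).contMDiffWithinAt

end IwaseHandle
end Literature.Topology.FourManifolds
end
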